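import Summits.QuantumFields.YangMills.Theorems.SwapTwistDeficitEigenData
import Summits.QuantumFields.YangMills.Theorems.SwapTwistDeficitTwistTraceSpectral
import HarnessLib

/-!
# The two-insertion trace and the swap-twisted trace along ONE eigen-data

Support module for the door `SwapTwistDeficit.CauchySchwarzDoor` (stmt-QuantumFields-23319, aside of route `SwapTwistDeficit`, D-0145
LINE g10-B of seat ym-idea-4).  The existential spectral representations `insTrace_spectral` (two-insertion trace) and `twistTrace_spectral`
(swap-twisted trace) are re-proved here RELATIVE TO GIVEN EIGEN-DATA (`exists_eigenData` of the companion module: a Hilbert basis `b` of `L²`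
through the complete physical eigenbasis `e_k`, eigenvalues `lam` of the `L²` operator of `K_β^P`, embedding `emb`), so that the parity
argument of the Cauchy–Schwarz door can use the SAME eigen-sequence for both traces:

* `eigenData_insTrace` — `insTrace L β O m = Σ_{(k,l)} λ_k^{2L-m} λ_l^m (∫ O e_k e_l)²` (`HasSum` on `ℕ × ℕ`, `1 ≤ m ≤ 2L - 2`);
* `eigenData_twistTrace` — `twistTrace L β T = Σ_k λ_k^T ∫ e_k (e_k ∘ S)` (`T ≥ 3`).

Proofs: the one-bond-insertion forms `insTrace_eq_insertOne` ∕ `twistTraceSucc_eq_insertOne` fed to Literature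
`hasSum_integral_iterate_insert_one` along `b`; diagonal matrix elements through the honest eigenfunctions (`integral_iterKernelP_mul`,
`eigenData_bilinear`, `integral_physKernel_mul_of_isPhys`).

HONEST FRAMING: fixed-lattice spectral bookkeeping for an M-sized aside item of a DRAFT line onto a RECORD rung (K2a); no renormalisation-group
content; nothing here bears on infinite volume, the continuum limit, a mass gap or Clay.
References: [cite: ReedSimonI1980, Thm. VI.22–VI.23]; [cite: MontvayMunster1994, (3.145)]; [cite: tHooft1979Flux].
-/

set_option autoImplicit false

noncomputable section

open MeasureTheory Filter Topology Function
open Literature.MathematicalPhysics.QuantumFieldTheory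
open Literature.MathematicalPhysics.QuantumLattice
open Literature.Analysis.OperatorTheory.YMMatrixModel
open Literature.Analysis.OperatorTheory
open scoped InnerProductSpace BigOperators

namespace Summit.QuantumFields.YangMills.Theorems.FemtoTransferGap.TT

open Summit.QuantumFields.YangMills.Theorems.FemtoTransferGap
open Summit.QuantumFields.YangMills.Theorems.FemtoTransferGap.PhysL2

variable {L : ℕ} [NeZero L]

variable {ι : Type} [Countable ι] {b : HilbertBasis ι ℝ (Lp ℝ 2 (configMeasure SU2 L))} {lam : ι → ℝ}
  {AP : Lp ℝ 2 (configMeasure SU2 L) →L[ℝ] Lp ℝ 2 (configMeasure SU2 L)} {emb : ℕ → ι}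
  {e : ℕ → (GaugeConfig 3 L SU2 → ℝ)} {β : ℝ}

set_option maxHeartbeats 800000 in
/-- **The two-insertion trace along given eigen-data**: for `β > 0`, a physical `O` with `|O| ≤ C_O` and `1 ≤ m ≤ 2L - 2`,
`insTrace L β O m = Σ_{(k,l)} λ_k^{2L-m} λ_l^m (∫ O e_k e_l)²` as a `HasSum` on `ℕ × ℕ`. [cite: ReedSimonI1980, Thm. VI.22–VI.23]
[cite: MontvayMunster1994, (3.145)] -/
theorem eigenData_insTrace (hβ : 0 < β)
    (hAP : ∀ φ : Lp ℝ 2 (configMeasure SU2 L),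
      (AP φ : GaugeConfig 3 L SU2 → ℝ) =ᵐ[configMeasure SU2 L] fun x => ∫ y, physKernel β x y * φ y ∂configMeasure SU2 L)
    (hsa : IsSelfAdjoint AP) (hbAP : ∀ i, AP (b i) = lam i • b i) (hinj : Function.Injective emb)
    (hoff : ∀ i ∉ Set.range emb, lam i = 0) (hlam : ∀ k, lam (emb k) = levelValue su2Rep L β k)
    (hbe : ∀ k, ((b (emb k) : Lp ℝ 2 (configMeasure SU2 L)) : GaugeConfig 3 L SU2 → ℝ) =ᵐ[configMeasure SU2 L] e k)
    (he : ∀ k, IsPhys (e k)) {O : GaugeConfig 3 L SU2 → ℝ} (hO : IsPhys O) {CO : ℝ} (hOb : ∀ U, |O U| ≤ CO)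
    {m : ℕ} (hm : 1 ≤ m) (hmL : m + 2 ≤ 2 * L) :
    HasSum (fun p : ℕ × ℕ => levelValue su2Rep L β p.1 ^ (2 * L - m) * levelValue su2Rep L β p.2 ^ m *
        (∫ U, O U * e p.1 U * e p.2 U ∂configMeasure SU2 L) ^ 2) (insTrace L β O m) := by
  classical
  have hCO : 0 ≤ CO := (abs_nonneg _).trans (hOb (fun _ => 1))
  obtain ⟨M0, -, hM0⟩ := exists_abs_transferKernel_le (L := L) β
  have hKP := stronglyMeasurable_physKernel (L := L) β
  have hCP : ∀ U V : GaugeConfig 3 L SU2, ‖physKernel β U V‖ ≤ M0 := fun U V => by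
    rw [Real.norm_eq_abs]; exact abs_physKernel_le hM0 U V
  have hmL' : m ≤ 2 * L - 1 := by omega
  -- the honest bounded observables `g_k = O · e_k`
  have hgm : ∀ k, Measurable fun U => O U * e k U := fun k => hO.measurable.mul (he k).measurable
  have hgb : ∀ k, ∃ B, ∀ U, ‖O U * e k U‖ ≤ B := fun k => by
    obtain ⟨D, hD⟩ := (he k).bounded
    exact ⟨CO * D, fun U => by rw [norm_mul, Real.norm_eq_abs, Real.norm_eq_abs]; exact mul_le_mul (hOb U) (hD U) (abs_nonneg _) hCO⟩
  choose Bg hBg using hgb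
  -- the composite bond `X_m`
  obtain ⟨hKit, Bm, hBm⟩ := measurable_bdd_iterKernelP (L := L) β (m - 1)
  set X : GaugeConfig 3 L SU2 → GaugeConfig 3 L SU2 → ℝ := fun x y =>
    O x * ((fun f : GaugeConfig 3 L SU2 → ℝ => fun w => ∫ z, physKernel β w z * f z ∂configMeasure SU2 L)^[m - 1]
      (fun w => physKernel β w y)) x * O y with hXdef
  have hX : StronglyMeasurable (uncurry X) := by
    have h1 : Measurable (uncurry X) :=
      ((hO.measurable.comp measurable_fst).mul hKit).mul (hO.measurable.comp measurable_snd)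
    exact h1.stronglyMeasurable
  have hObn : ∀ U, ‖O U‖ ≤ CO := fun U => by rw [Real.norm_eq_abs]; exact hOb U
  have hCX : ∀ x y, ‖X x y‖ ≤ CO * Bm * CO := fun x y => by
    simp only [hXdef]
    rw [norm_mul, norm_mul]
    have h1 := hBm x y
    exact mul_le_mul (mul_le_mul (hObn x) h1 (norm_nonneg _) hCO) (hObn y) (norm_nonneg _) (mul_nonneg hCO ((norm_nonneg _).trans h1))
  obtain ⟨Xop, hXop⟩ := exists_kernelOp (μ := configMeasure SU2 L) hX hCX
  -- Literature: the one-bond-insertion spectral sum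
  have hmain := hasSum_integral_iterate_insert_one (μ := configMeasure SU2 L) (b := b) hKP hCP (physKernel_symm β) hAP hbAP hX hCX hXop
    (2 * L - m - 2)
  rw [show 2 * L - m - 2 + 1 = 2 * L - 1 - m by omega, ← insTrace_eq_insertOne β hO hm hmL'] at hmain
  -- the diagonal matrix elements through the honest eigenfunctions
  have hdiag : ∀ k, ⟪b (emb k), Xop (b (emb k))⟫_ℝ = ∫ x, (O x * e k x) *
      ((fun f : GaugeConfig 3 L SU2 → ℝ => fun w => ∫ z, physKernel β w z * f z ∂configMeasure SU2 L)^[m] (fun U => O U * e k U)) x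
        ∂configMeasure SU2 L := by
    intro k
    rw [inner_kernelOp_eq_integral hXop]
    refine integral_congr_ae ?_
    filter_upwards [hbe k] with x hx
    rw [hx]
    have hin : ∫ y, X x y * ((b (emb k) : Lp ℝ 2 (configMeasure SU2 L)) : GaugeConfig 3 L SU2 → ℝ) y ∂configMeasure SU2 L =
        ∫ y, X x y * e k y ∂configMeasure SU2 L :=
      integral_congr_ae (by filter_upwards [hbe k] with y hy; rw [hy])
    rw [hin]
    simp only [hXdef]
    have key := integral_iterKernelP_mul (L := L) β (hgm k) (hBg k) (m - 1) x
    rw [show m - 1 + 1 = m by omega] at key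
    rw [← key, ← integral_const_mul, ← integral_const_mul]
    exact integral_congr_ae (ae_of_all _ fun y => by ring)
  -- the inner sums (bilinear spectral expansion)
  have hinner : ∀ k, HasSum (fun l : ℕ => levelValue su2Rep L β l ^ m * (∫ U, O U * e k U * e l U ∂configMeasure SU2 L) ^ 2)
      ⟪b (emb k), Xop (b (emb k))⟫_ℝ := by
    intro k
    rw [hdiag k]
    have h := eigenData_bilinear hAP hsa hbAP hinj hoff hlam hbe (hgm k) (hBg k) (hgm k) (hBg k) hm
    refine h.congr_fun fun l => ?_
    ring
  -- the outer sum over `ℕ`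
  have houter : HasSum (fun k : ℕ => levelValue su2Rep L β k ^ (2 * L - m) * ⟪b (emb k), Xop (b (emb k))⟫_ℝ) (insTrace L β O m) := by
    have h0 : ∀ i ∉ Set.range emb, lam i ^ (2 * L - m - 2 + 2) * ⟪b i, Xop (b i)⟫_ℝ = 0 := fun i hi => by
      rw [hoff i hi, zero_pow (by omega), zero_mul]
    have h2 := (Function.Injective.hasSum_iff hinj h0).mpr hmain
    refine h2.congr_fun fun k => ?_
    simp only [Function.comp_apply, hlam k, show 2 * L - m - 2 + 2 = 2 * L - m by omega]
  -- iterated sum of non-negative terms ⇒ double sum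
  set F : ℕ × ℕ → ℝ := fun p => levelValue su2Rep L β p.1 ^ (2 * L - m) * levelValue su2Rep L β p.2 ^ m *
    (∫ U, O U * e p.1 U * e p.2 U ∂configMeasure SU2 L) ^ 2 with hF
  have hF0 : ∀ p, 0 ≤ F p := fun p =>
    mul_nonneg (mul_nonneg (pow_nonneg (levelValue_su2Rep_pos hβ _).le _) (pow_nonneg (levelValue_su2Rep_pos hβ _).le _)) (sq_nonneg _)
  have hfib : ∀ k, HasSum (fun l => F (k, l)) (levelValue su2Rep L β k ^ (2 * L - m) * ⟪b (emb k), Xop (b (emb k))⟫_ℝ) := fun k => by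
    have h := (hinner k).mul_left (levelValue su2Rep L β k ^ (2 * L - m))
    refine h.congr_fun fun l => ?_
    simp only [hF]; ring
  have hsumF : Summable F := by
    refine (summable_prod_of_nonneg hF0).mpr ⟨fun k => (hfib k).summable, ?_⟩
    refine houter.summable.congr fun k => ?_
    exact ((hfib k).tsum_eq).symm
  have htot := hsumF.hasSum.prod_fiberwise hfib
  have heq : ∑' p, F p = insTrace L β O m := htot.unique houter
  rw [← heq]
  exact hsumF.hasSum

set_option maxHeartbeats 800000 in
/-- **The swap-twisted trace along given eigen-data**: `twistTrace L β T = Σ_k λ_k^T ∫ e_k (e_k ∘ S)` for `T ≥ 3`, `S` the spatial axis swap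
`(0 1)`. [cite: tHooft1979Flux] [cite: ReedSimonI1980, Thm. VI.22–VI.23] -/
theorem eigenData_twistTrace
    (hAP : ∀ φ : Lp ℝ 2 (configMeasure SU2 L),
      (AP φ : GaugeConfig 3 L SU2 → ℝ) =ᵐ[configMeasure SU2 L] fun x => ∫ y, physKernel β x y * φ y ∂configMeasure SU2 L)
    (hbAP : ∀ i, AP (b i) = lam i • b i) (hinj : Function.Injective emb)
    (hoff : ∀ i ∉ Set.range emb, lam i = 0) (hlam : ∀ k, lam (emb k) = levelValue su2Rep L β k)
    (hbe : ∀ k, ((b (emb k) : Lp ℝ 2 (configMeasure SU2 L)) : GaugeConfig 3 L SU2 → ℝ) =ᵐ[configMeasure SU2 L] e k)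
    (he : ∀ k, IsPhys (e k)) (heig : ∀ k, transferApply β (e k) = levelValue su2Rep L β k • e k) {T : ℕ} (hT : 3 ≤ T) :
    HasSum (fun k : ℕ => levelValue su2Rep L β k ^ T * ∫ U, e k U * e k (configPerm (Equiv.swap 0 1) U) ∂configMeasure SU2 L)
      (twistTrace L β T) := by
  classical
  set S := configPerm (G := SU2) (L := L) (Equiv.swap (0 : Fin 3) 1) with hSdef
  obtain ⟨M0, -, hM0⟩ := exists_abs_transferKernel_le (L := L) β
  have hKP := stronglyMeasurable_physKernel (L := L) β
  have hCP : ∀ U V : GaugeConfig 3 L SU2, ‖physKernel β U V‖ ≤ M0 := fun U V => by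
    rw [Real.norm_eq_abs]; exact abs_physKernel_le hM0 U V
  obtain ⟨m, rfl⟩ : ∃ m, T = m + 3 := ⟨T - 3, by omega⟩
  set X : GaugeConfig 3 L SU2 → GaugeConfig 3 L SU2 → ℝ := fun x y => physKernel β (S x) y with hXdef
  have hX : StronglyMeasurable (uncurry X) := by
    have e1 : uncurry X = (uncurry fun x y : GaugeConfig 3 L SU2 => physKernel (L := L) β x y) ∘ (fun p => (S p.1, p.2)) := by
      funext p; rcases p with ⟨a, b'⟩
      simp only [hXdef, Function.uncurry_apply_pair, Function.comp_apply]
    rw [e1]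
    exact hKP.comp_measurable ((S.measurable.comp measurable_fst).prodMk measurable_snd)
  have hCX : ∀ x y, ‖X x y‖ ≤ M0 := fun x y => hCP _ _
  obtain ⟨Xop, hXop⟩ := exists_kernelOp (μ := configMeasure SU2 L) hX hCX
  have hmain := hasSum_integral_iterate_insert_one (μ := configMeasure SU2 L) (b := b) hKP hCP (physKernel_symm β) hAP hbAP hX hCX hXop m
  have htw : twistTrace L β (m + 3) = ∫ x, ∫ y, X x y *
      ((fun f : GaugeConfig 3 L SU2 → ℝ => fun w => ∫ z, physKernel β w z * f z ∂configMeasure SU2 L)^[m + 1]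
        (fun z => physKernel β z x)) y ∂configMeasure SU2 L ∂configMeasure SU2 L := by
    rw [twistTrace, show m + 3 - 1 = (m + 1) + 1 by omega, twistTraceSucc_eq_insertOne β (m + 1)]
  rw [← htw] at hmain
  have hdiag : ∀ k, ⟪b (emb k), Xop (b (emb k))⟫_ℝ =
      levelValue su2Rep L β k * ∫ U, e k U * e k (S U) ∂configMeasure SU2 L := by
    intro k
    rw [inner_kernelOp_eq_integral hXop]
    have hin : ∀ x, ∫ y, X x y * ((b (emb k) : Lp ℝ 2 (configMeasure SU2 L)) : GaugeConfig 3 L SU2 → ℝ) y ∂configMeasure SU2 L =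
        levelValue su2Rep L β k * e k (S x) := by
      intro x
      have h1 : ∫ y, X x y * ((b (emb k) : Lp ℝ 2 (configMeasure SU2 L)) : GaugeConfig 3 L SU2 → ℝ) y ∂configMeasure SU2 L =
          ∫ y, X x y * e k y ∂configMeasure SU2 L :=
        integral_congr_ae (by filter_upwards [hbe k] with y hy; rw [hy])
      rw [h1]
      simp only [hXdef]
      rw [integral_physKernel_mul_of_isPhys hM0 (he k) (S x), ← transferApply_apply, heig k, Pi.smul_apply, smul_eq_mul]
    rw [← integral_const_mul]
    refine integral_congr_ae ?_
    filter_upwards [hbe k] with x hx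
    rw [hx, hin x]; ring
  have h0 : ∀ i ∉ Set.range emb, lam i ^ (m + 2) * ⟪b i, Xop (b i)⟫_ℝ = 0 := fun i hi => by
    rw [hoff i hi, zero_pow (by omega), zero_mul]
  have h2 := (Function.Injective.hasSum_iff hinj h0).mpr hmain
  refine h2.congr_fun fun k => ?_
  simp only [Function.comp_apply, hlam k, hdiag k]
  ring

end Summit.QuantumFields.YangMills.Theorems.FemtoTransferGap.TT

end
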